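import Mathlib.Algebra.Polynomial.Eval.Defs
import Literature.Computability.Complexity.BoolEncodings
import Literature.Computability.Complexity.Classes
import Literature.Computability.Complexity.ProbabilisticClasses
import Literature.Computability.Complexity.Circuit
import HarnessLib

-- provenance: harness21/H21/H21/Prelude/CplxCore/CircuitClasses.lean @ 7a08ad6 (interim HEAD d8f2665); M5 mechanical rewrite
/-!
# Non-uniform circuit size classes: `SIZE(s)` and `P/poly` (trunk CplxCore, item C14)

This file defines circuit families `(Cₙ)ₙ` (one circuit `Cₙ : Circuit (Fin n)` per input length),
what it means for a family to decide a language `L ⊆ {0,1}*`, the size classes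
`SIZE(s) = {L | L is decided by a B₂-circuit family of size ≤ s(n)}`, the class
`P/poly = ⋃_{p polynomial} SIZE(p)`, the circuit complexity `n ↦ size_{B₂}(L ∩ {0,1}ⁿ)` of a
language, and the advice operator `C ↦ C/poly`. The API records the standard facts
`P/poly = P/poly-advice` (Arora–Barak Thm. 6.18), `P ⊆ P/poly` (Thm. 6.6), Adleman's theorem
`BPP ⊆ P/poly` (Thm. 7.14), monotonicity of `SIZE` and closure of `P/poly` under complement.

Sources: S. Arora, B. Barak, *Computational Complexity: A Modern Approach* (2009), Def. 6.1–6.5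
(circuit families, `SIZE`, `P/poly`), Def. 6.16–Thm. 6.18 (advice), Thm. 6.6 (`P ⊆ P/poly`),
Thm. 7.14 (Adleman 1978, `BPP ⊂ P/poly`); H. Vollmer, *Introduction to Circuit Complexity*
(1999), §1.3.

Mathlib has no Boolean circuits nor non-uniform classes (searched `P/poly`, `Ppoly`, `SIZE`,
`CircuitFamily`, `advice`: nothing); we reuse `Polynomial.eval`, `Language`, `Set.boolIndicator`
and the H21 prelude (`Circuit`, `B2`, `circuitSizeOver`, `Language.sliceFn`, `boolPair`, `P`,
`BPP`, `co`).

Design choices: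
* Circuits are over the basis `B2` (all gates of fan-in `≤ 2`, including the two constants of
  arity `0`), as in Arora–Barak Def. 6.1. Since `B2` contains the constant gates, every Boolean
  function on `Fin n` variables — including `n = 0` — is computed by some `B2`-circuit, so
  `Language.circuitSize` never takes the junk value `0` of `circuitSizeOver` spuriously.
* `CircuitFamily.Decides` compares `(C |x|).eval x.get` with `L.boolIndicator x`, hence is
  `noncomputable` (D7).
* `PPoly` is the union over `p : Polynomial ℕ` of `SIZE (fun n => p.eval n)`; `polyAdvice C` is the
  generic advice operator `C/poly` with advice glued to the input by `boolPair` (D7: never a bare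
  suffix).
* All declarations live in `namespace Literature.CplxCore`, except `Language.circuitSize`, a deliberate
  dot-notation extension of Mathlib's `Language` (like `Language.sliceFn` in `BoolEncodings`).
-/

namespace Literature.Computability.Complexity

/-! ### Circuit families and the languages they decide -/

/-- A *circuit family*: one Boolean circuit `C n` on `n` input variables `Fin n` for every input
length `n` (Arora–Barak 2009, Def. 6.2). [cite: AroraBarak2009, Def. 6.2] -/
abbrev CircuitFamily : Type := ∀ n : ℕ, Circuit (Fin n)

/-- The circuit family `C` *decides* the language `L ⊆ {0,1}*`: for every string `x`, the circuit
`C |x|` on input `x` outputs `1` iff `x ∈ L` (Arora–Barak 2009, Def. 6.2). Noncomputable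
(`Set.boolIndicator`). [cite: AroraBarak2009, Def. 6.2] -/
noncomputable def CircuitFamily.Decides (C : CircuitFamily) (L : Language Bool) : Prop :=
  ∀ x : List Bool, (C x.length).eval x.get = L.boolIndicator x

/-! ### Size classes -/

/-- `SIZE s`: the languages decided by a family of `B₂`-circuits `(Cₙ)` with `|Cₙ| ≤ s n` for
every `n` (Arora–Barak 2009, Def. 6.2 and Def. 6.5; Vollmer 1999, §1.3). See also `io (SIZE s)`
(`Classes.io`) for the infinitely-often variant used in circuit lower bounds. [cite: AroraBarak2009, Def. 6.2 and Def. 6.5] -/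
noncomputable def SIZE (s : ℕ → ℕ) : Set (Language Bool) :=
  {L | ∃ C : CircuitFamily, (∀ n, (C n).IsOver B2 ∧ (C n).size ≤ s n) ∧ C.Decides L}

/-- `P/poly = ⋃_{p} SIZE(p(n))`, the languages decided by polynomial-size circuit families
(Arora–Barak 2009, Def. 6.5). [cite: AroraBarak2009, Def. 6.5] -/
noncomputable def PPoly : Set (Language Bool) :=
  ⋃ p : Polynomial ℕ, SIZE (fun n => p.eval n)

end Literature.Computability.Complexity

/-- The circuit complexity of the language `L` at length `n`: the least size of a `B₂`-circuit
computing the slice `L ∩ {0,1}ⁿ` as a Boolean function `(Fin n → Bool) → Bool`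
(Arora–Barak 2009, Def. 6.1–6.2; Vollmer 1999, Def. 1.7). Since `B₂` contains the constant
gates, the infimum in `circuitSizeOver` is always attained here. Deliberate dot-notation
extension of Mathlib's `Language`. [cite: AroraBarak2009, Def. 6.1–6.2] -/
noncomputable def Language.circuitSize (L : Language Bool) (n : ℕ) : ℕ :=
  Literature.Computability.Complexity.circuitSizeOver Literature.Computability.Complexity.B2 (L.sliceFn n)

namespace Literature.Computability.Complexity

/-! ### Advice -/

/-- The polynomial-advice operator `C ↦ C/poly`: `L ∈ polyAdvice C` iff there are `L' ∈ C`, an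
advice sequence `a : ℕ → {0,1}*` of polynomially bounded length, such that
`x ∈ L ↔ ⟨x, a |x|⟩ ∈ L'` (pairing via `boolPair`) (Arora–Barak 2009, Def. 6.16;
Karp–Lipton 1980). [cite: AroraBarak2009, Def. 6.16] -/
def polyAdvice (C : Set (Language Bool)) : Set (Language Bool) :=
  {L | ∃ L' ∈ C, ∃ a : ℕ → List Bool, ∃ p : Polynomial ℕ,
    (∀ n, (a n).length ≤ p.eval n) ∧ ∀ x, x ∈ L ↔ boolPair x (a x.length) ∈ L'}

/-! ### API -/

/-- `P/poly` coincides with the class of languages decidable in polynomial time with polynomial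
advice: `P/poly = P/poly-advice` (Arora–Barak 2009, Thm. 6.18). [cite: AroraBarak2009, Thm. 6.18] -/
def PPoly_eq_polyAdvice_P : Prop :=
  PPoly = polyAdvice Classes.P

/-- `P ⊆ P/poly`: polynomial-time machines are simulated by polynomial-size circuit families
(Arora–Barak 2009, Thm. 6.6). [cite: AroraBarak2009, Thm. 6.6] -/
def P_subset_PPoly : Prop :=
  Classes.P ⊆ PPoly

/-- **Adleman's theorem** `BPP ⊆ P/poly` (Adleman 1978; Arora–Barak 2009, Thm. 7.14). [cite: Adleman1978] -/
def BPP_subset_PPoly : Prop :=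
  BPP ⊆ PPoly

/-- A language is in `SIZE s` iff its circuit complexity at every length `n` is at most `s n`
(Arora–Barak 2009, Def. 6.2). The reverse direction uses that over `B₂` the infimum defining
`Language.circuitSize` is attained. [cite: AroraBarak2009, Def. 6.2] -/
def mem_SIZE_iff_circuitSize_le : Prop :=
  ∀ (L : Language Bool) (s : ℕ → ℕ),
    L ∈ SIZE s ↔ ∀ n, L.circuitSize n ≤ s n

/-- `SIZE` is monotone in the size bound (Arora–Barak 2009, Def. 6.2). [cite: AroraBarak2009, Def. 6.2] -/
theorem SIZE_mono {s s' : ℕ → ℕ} (h : ∀ n, s n ≤ s' n) : SIZE s ⊆ SIZE s' := by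
  rintro L ⟨C, hC, hL⟩
  exact ⟨C, fun n => ⟨(hC n).1, (hC n).2.trans (h n)⟩, hL⟩

/-- `SIZE s ⊆ P/poly` whenever `s` is bounded by a polynomial (Arora–Barak 2009, Def. 6.5). [cite: AroraBarak2009, Def. 6.5] -/
theorem SIZE_subset_PPoly {s : ℕ → ℕ} (p : Polynomial ℕ) (h : ∀ n, s n ≤ p.eval n) :
    SIZE s ⊆ PPoly :=
  fun _ hL => Set.mem_iUnion.2 ⟨p, SIZE_mono h hL⟩

/-- `P/poly` is closed under complement: `co P/poly = P/poly` (negate the output gate; over `B₂`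
this costs at most one extra gate) (Arora–Barak 2009, §6.1). [cite: AroraBarak2009, §6.1] -/
def co_PPoly : Prop :=
  co PPoly = PPoly

end Literature.Computability.Complexity
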